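import Summits.Ventures.Crystal3D.Theorems.StickyWulffConstantGenericWallFloorEndBallMenuDefs
import HarnessLib

/-!
# §51 interface — BLOCKER SITES of an empty slot (definition): the on-menu positions within distance `< 1` of a slot site
# (crux `GenericWallFloor`, stmt-Ventures-19480, line `WallLedgerG`; 19480-p1 → cf-p1 2026-08-28T21:43Z recommendation (3): enumerate
# (contacts, blocker pattern per empty slot) instead of the second shell)

HONEST FRAMING. Venture `Summits/Ventures/Crystal3D` (cell `crystal3d-full`), helper vocabulary for the crux `GenericWallFloor` of
`route-Ventures-StickyWulffConstant`, REGISTERED line `WallLedgerG`, open stub `stub_twoSlabAdhesion`.  ONE DEFINITION (computable); the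
consuming theorem `blocker_mem_blockerSites_or_payer` is the sequel `…GenericWallFloorEndBallBlocker`.  Nothing is claimed about packings;
F-C1 not moved.

* `blockerSites i` — the menu sites `q ∈ menuQ3` (q3 cubic coordinates of the anchor frame) that do not overlap the centre
  (`sdot3 q q ≥ 18`) and lie within distance `< 1` of the slot site `3 • slotInt i` (`sdot3 (q − 3σ) (q − 3σ) < 18`): the positions at
  which an ON-MENU ball can BLOCK the empty slot `i` of an end ball.  For every `i` these are exactly SEVEN sites (`blockerSites_zero`
  in the sequel for `i = 0`, the others by the cubic symmetry): the slot site `3σ` itself, the four TWIN CONTACTS of the centre adjacent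
  to it (`|q|² = 18`, at `√(1/3)` from the site) and the two TWIN `√2`-SITES (`|q|² = 36`, at `√(1/3)`).  Every other blocker of an empty
  slot is OFF the menu — hence payer-accompanied by `mem_menuQ3_or_payer_of_near_endBall` when within `√3` of the centre — or farther
  than `√3` from the centre (outside the universe lemma's radius; honest gap).
WHAT THIS IS NOT: no statement about configurations; F-C1 not moved.
-/

namespace Summit.Ventures.Crystal3D.Theorems

open Summit.Ventures.Crystal3D Finset NearIdentity

/-- **Blocker sites of the slot `i`:** menu sites not overlapping the centre and within distance `< 1` of the slot site `3 • slotInt i`. -/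
def blockerSites (i : Fin 12) : Finset (Fin 3 → ℤ) :=
  menuQ3.filter fun q => 18 ≤ sdot3 q q ∧ sdot3 (q - 3 • slotInt i) (q - 3 • slotInt i) < 18

end Summit.Ventures.Crystal3D.Theorems
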